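/-
Width seat `ym-line-cbag-p1-w3` (prover-ym-line-cbag-p1-w3-g8-0; own items stmt-QuantumFields-22254 `BoxFloorAllGroups` /
stmt-QuantumFields-22893 `ExpChartPackage2` CLOSED proved), helping LINE 3 `route-QuantumFields-SixPlaneColdBox`
(crux stmt-QuantumFields-25709 `DensityTransferG`): the numeric half of the SHARP one-scale kernel-covariance expansion with datum — the
covariance core's error sum is eventually `≤ β^{−1/5}` (not merely `≤ β^{−θ/2}`).
-/
import Summits.QuantumFields.YangMills.Theorems.SixPlaneColdBoxKernelMeanSharpGBounds

/-!
# LINE 3 `SixPlaneColdBox`, glue «KernelCovPairsG», part 2a: the covariance core's error sum is eventually `≤ β^{−1/5}`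

With the PLAN-v6 parameters of `eventually_kernelDatum_boundsG` (`δ = θ/5`, `ε = 6θ`, `r = Ca·β^{3θ+θ/5−1/2}`, `m = 2L`, `R = β^{6θ}/(4(√D+1))`) the
five terms of COV-RHS `= 6(2Nβ)²pY + 3M²(e^{2w}−1) + 6M²P + 2τ(M+K₁) + √P(2MK₁+K₂+K₁²)` are `≲ β²e^{−β^{6θ}}`, `β^{52θ−1/2} + β^{44θ−1}`,
`β^{28θ}e^{−bβ^{12θ}}`, `β^{36θ−1/2}`, `β^{26.8θ}e^{−bβ^{12θ}}` (p1's majorants), hence each is eventually `≤ β^{−1/5}/5` for `0 < θ ≤ 1/200`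
(binding exponent `52θ − 1/2 ≤ −0.24 < −1/5`).  Crux `DensityTransferG` compares the kernel covariance of two plaquette costs at separation
`T = ⌈β^A⌉` (signal `(D/2)·C_D² ≍ β^{−8A}` in `β²`-units, `A < θ ≤ 1/200`) for all 36 plane pairs, so any error `o(β^{−8A})` — in particular
`β^{−1/5}` — suffices, whereas the interface's `β^{−θ/2}` does not when `16A > θ`.

* `eventually_covD_T1_sharp` … `eventually_covD_T5_sharp` — the five terms, each eventually `≤ β^{−1/5}/5` (p1's proofs with the new target);
* **`eventually_kernelCov_boundsG_sharp`** — the window clauses of `eventually_kernelDatum_boundsG` (`1 ≤ β`, `L ≤ η₀`, `m ≤ 1/4`, `m ≤ r₂`,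
  `mE ≤ m`, `r ≤ m`, the sandwich window, `P ≤ 1/2`) with the sharp last clause COV-RHS `≤ β^{−(1/5)}`, in the spelling `√(β·B)` of
  `kernelCovG_sub_interface_le`.

Pure real analysis; no sorry; no definition; standard axioms.  NOT a claim about the Yang–Mills mass gap: glue for a LINE onto the RECORD-type
node `LatticeNonFreezing`; no summit statement is touched.
-/

set_option autoImplicit false

noncomputable section

open Filter Topology Finset Real

namespace Summit.QuantumFields.YangMills.Theorems.ColdBoxAllGroups

open Summit.QuantumFields.YangMills.Theorems.WeakCouplingRates
open Literature.MathematicalPhysics.QuantumFieldTheory.Balaban1983to89.B9Eq376POneLetters (exp_two_mul_sub_one_le_four_mul)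

variable {θ Ca CE C₂ : ℝ}

/-! ## The error terms of the covariance core, eventually `≤ β^{−1/5}/5` each -/

/-- **C1** (YM large fields): `6(2Nβ)²e^{−β^{6θ}} ≤ β^{−1/5}/5` eventually. -/
theorem eventually_covD_T1_sharp (N : ℕ) (hθ : 0 < θ) :
    ∀ᶠ β : ℝ in atTop, 6 * (2 * (N : ℝ) * β) * (2 * (N : ℝ) * β) * Real.exp (-(β ^ (6 * θ))) ≤ β ^ (-(1 / 5 : ℝ)) / 5 := by
  refine eventually_le_rpow_div_of_le_rpow_mul_exp (C := 24 * (N : ℝ) ^ 2) (s := 2) (a := 6 * θ) (b₀ := 1) (-(1 / 5 : ℝ))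
    (by positivity) one_pos (by norm_num) (fun β hβ => le_of_eq ?_)
  rw [one_mul, Real.rpow_two]; ring

/-- **C2** (tilt): `3M²(e^{2w}−1) ≤ β^{−1/5}/5` eventually. -/
theorem eventually_covD_T2_sharp (hθ : 0 < θ) (hθ2 : θ ≤ 1 / 200) (hCa : 0 ≤ Ca) (hC₂ : 0 ≤ C₂) :
    ∀ᶠ β : ℝ in atTop, 3 * (β ^ (2 * (6 * θ))) ^ 2 * (Real.exp (2 * (120 * (2 * (⌈β ^ θ⌉₊ : ℝ) + 1) ^ 4 * (190 * β * (2 * ((12 * (⌈β ^ θ⌉₊ : ℝ) ^ 2 + 2 * ⌈β ^ θ⌉₊ + 1) * (Real.sqrt 2 * Real.sqrt (β ^ (2 * (6 * θ) - 1)) + 8 * (Ca * β ^ (3 * θ + θ / 5 - 1 / 2))))) ^ 3) + 4 * (2 * (⌈β ^ θ⌉₊ : ℝ) + 1) ^ 4 * (2 * C₂ * (2 * ((12 * (⌈β ^ θ⌉₊ : ℝ) ^ 2 + 2 * ⌈β ^ θ⌉₊ + 1) * (Real.sqrt 2 * Real.sqrt (β ^ (2 * (6 * θ) - 1)) + 8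 * (Ca * β ^ (3 * θ + θ / 5 - 1 / 2))))) ^ 2))) - 1) ≤ β ^ (-(1 / 5 : ℝ)) / 5 := by
  filter_upwards [eventually_tiltD_le_half hθ hθ2 hCa hC₂,
    eventually_le_rpow_div_of_le_rpow (f := fun β => 12 * (120 * 625 * 190 * (106 * (Real.sqrt 2 + 8 * Ca)) ^ 3) * β ^ (52 * θ - 1 / 2)) (b := -(1 / 5 : ℝ)) (s := 52 * θ - 1 / 2)
      (by linarith) (by norm_num : (0 : ℝ) < 10) (fun β _ => le_rfl),
    eventually_le_rpow_div_of_le_rpow (f := fun β => 12 * (4 * 625 * (2 * C₂) * (106 * (Real.sqrt 2 + 8 * Ca)) ^ 2) * β ^ (44 * θ - 1)) (b := -(1 / 5 : ℝ)) (s := 44 * θ - 1)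
      (by linarith) (by norm_num : (0 : ℝ) < 10) (fun β _ => le_rfl),
    eventually_ge_atTop (1 : ℝ)] with β hw h1 h2 hβ
  have hβ0 : 0 < β := by linarith
  have hr0 : 0 ≤ Ca * β ^ (3 * θ + θ / 5 - 1 / 2) := mul_nonneg hCa (Real.rpow_nonneg hβ0.le _)
  have hw0 : 0 ≤ (120 * (2 * (⌈β ^ θ⌉₊ : ℝ) + 1) ^ 4 * (190 * β * (2 * ((12 * (⌈β ^ θ⌉₊ : ℝ) ^ 2 + 2 * ⌈β ^ θ⌉₊ + 1) * (Real.sqrt 2 * Real.sqrt (β ^ (2 * (6 * θ) - 1)) + 8 * (Ca * β ^ (3 * θ + θ / 5 - 1 / 2))))) ^ 3) + 4 * (2 * (⌈β ^ θ⌉₊ : ℝ) + 1) ^ 4 * (2 * C₂ * (2 * ((12 * (⌈β ^ θ⌉₊ : ℝ) ^ 2 + 2 * ⌈β ^ θ⌉₊ + 1) * (Real.sqrt 2 * Real.sqrt (β ^ (2 * (6 * θ) - 1)) + 8 * (Ca * β ^ (3 * θ + θ / 5 - 1 / 2))))) ^ 2)) := by positivity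
  have hexp := exp_two_mul_sub_one_le_four_mul hw0 hw
  have hW := tiltD_majorant hβ hθ.le hCa hC₂
  rw [rpow_two_mul_six_sq hβ0.le]
  have e1 : β ^ (24 * θ) * β ^ (28 * θ - 1 / 2) = β ^ (52 * θ - 1 / 2) := by rw [← Real.rpow_add hβ0]; ring_nf
  have e2 : β ^ (24 * θ) * β ^ (20 * θ - 1) = β ^ (44 * θ - 1) := by rw [← Real.rpow_add hβ0]; ring_nf
  have hM0 : 0 ≤ 3 * β ^ (24 * θ) := by positivity
  calc 3 * β ^ (24 * θ) * (Real.exp (2 * (120 * (2 * (⌈β ^ θ⌉₊ : ℝ) + 1) ^ 4 * (190 * β * (2 * ((12 * (⌈β ^ θ⌉₊ : ℝ) ^ 2 + 2 * ⌈β ^ θ⌉₊ + 1) * (Real.sqrt 2 * Real.sqrt (β ^ (2 * (6 * θ) - 1)) + 8 * (Ca * β ^ (3 * θ + θ / 5 - 1 / 2))))) ^ 3) + 4 * (2 * (⌈β ^ θ⌉₊ : ℝ) + 1) ^ 4 * (2 * C₂ * (2 * ((12 * (⌈β ^ θ⌉₊ : ℝ) ^ 2 + 2 * ⌈β ^ θ⌉₊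 + 1) * (Real.sqrt 2 * Real.sqrt (β ^ (2 * (6 * θ) - 1)) + 8 * (Ca * β ^ (3 * θ + θ / 5 - 1 / 2))))) ^ 2))) - 1) ≤ 3 * β ^ (24 * θ) * (4 * (120 * (2 * (⌈β ^ θ⌉₊ : ℝ) + 1) ^ 4 * (190 * β * (2 * ((12 * (⌈β ^ θ⌉₊ : ℝ) ^ 2 + 2 * ⌈β ^ θ⌉₊ + 1) * (Real.sqrt 2 * Real.sqrt (β ^ (2 * (6 * θ) - 1)) + 8 * (Ca * β ^ (3 * θ + θ / 5 - 1 / 2))))) ^ 3) + 4 * (2 * (⌈β ^ θ⌉₊ : ℝ) + 1) ^ 4 * (2 * C₂ * (2 * ((12 * (⌈β ^ θ⌉₊ : ℝ) ^ 2 + 2 * ⌈β ^ θ⌉₊ + 1) * (Real.sqrt 2 * Real.sqrt (β ^ (2 * (6 * θ) - 1)) + 8 * (Ca * β ^ (3 * θ + θ / 5 - 1 / 2))))) ^ 2))) := mul_le_mul_of_nonneg_left hexp hM0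
    _ ≤ 3 * β ^ (24 * θ) * (4 * ((120 * 625 * 190 * (106 * (Real.sqrt 2 + 8 * Ca)) ^ 3) * β ^ (28 * θ - 1 / 2) + (4 * 625 * (2 * C₂) * (106 * (Real.sqrt 2 + 8 * Ca)) ^ 2) * β ^ (20 * θ - 1))) := by gcongr
    _ = 12 * (120 * 625 * 190 * (106 * (Real.sqrt 2 + 8 * Ca)) ^ 3) * (β ^ (24 * θ) * β ^ (28 * θ - 1 / 2)) + 12 * (4 * 625 * (2 * C₂) * (106 * (Real.sqrt 2 + 8 * Ca)) ^ 2) * (β ^ (24 * θ) * β ^ (20 * θ - 1)) := by ring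
    _ = 12 * (120 * 625 * 190 * (106 * (Real.sqrt 2 + 8 * Ca)) ^ 3) * β ^ (52 * θ - 1 / 2) + 12 * (4 * 625 * (2 * C₂) * (106 * (Real.sqrt 2 + 8 * Ca)) ^ 2) * β ^ (44 * θ - 1) := by rw [e1, e2]
    _ ≤ β ^ (-(1 / 5 : ℝ)) / 5 := by linarith

/-- **C3** (Gaussian bad mass): `6M²P ≤ β^{−1/5}/5` eventually. -/
theorem eventually_covD_T3_sharp (D : ℕ) (hθ : 0 < θ) :
    ∀ᶠ β : ℝ in atTop, 6 * (β ^ (2 * (6 * θ))) ^ 2 * (240 * (D : ℝ) * (2 * (⌈β ^ θ⌉₊ : ℝ) + 1) ^ 4 * Real.exp (-(β ^ (6 * θ) / (4 * (Real.sqrt D + 1))) ^ 2 / 2)) ≤ β ^ (-(1 / 5 : ℝ)) / 5 := by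
  have hb₀ : (0 : ℝ) < (1 / (32 * (Real.sqrt D + 1) ^ 2)) := by positivity
  refine eventually_le_rpow_div_of_le_rpow_mul_exp (C := 6 * (150000 * (D : ℝ))) (s := 28 * θ) (a := 12 * θ) (b₀ := (1 / (32 * (Real.sqrt D + 1) ^ 2)))
    (-(1 / 5 : ℝ)) (by positivity) hb₀ (by norm_num) (fun β hβ => ?_)
  have hβ0 : 0 < β := by linarith
  have hP := (badMassD_majorant D hβ hθ.le).1
  rw [rpow_two_mul_six_sq hβ0.le]
  have e : β ^ (24 * θ) * β ^ (4 * θ) = β ^ (28 * θ) := by rw [← Real.rpow_add hβ0]; ring_nf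
  have hM0 : 0 ≤ 6 * β ^ (24 * θ) := by positivity
  calc 6 * β ^ (24 * θ) * (240 * (D : ℝ) * (2 * (⌈β ^ θ⌉₊ : ℝ) + 1) ^ 4 * Real.exp (-(β ^ (6 * θ) / (4 * (Real.sqrt D + 1))) ^ 2 / 2)) ≤ 6 * β ^ (24 * θ) * (150000 * (D : ℝ) * β ^ (4 * θ) * Real.exp (-((1 / (32 * (Real.sqrt D + 1) ^ 2)) * β ^ (12 * θ)))) := mul_le_mul_of_nonneg_left hP hM0
    _ = 6 * (150000 * (D : ℝ)) * (β ^ (24 * θ) * β ^ (4 * θ)) * Real.exp (-((1 / (32 * (Real.sqrt D + 1) ^ 2)) * β ^ (12 * θ))) := by ring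
    _ = _ := by rw [e]

/-- **C4** (surrogate): `2τ(M + K₁) ≤ β^{−1/5}/5` eventually. -/
theorem eventually_covD_T4_sharp (D : ℕ) (hθ : 0 < θ) (hθ2 : θ ≤ 1 / 200) (hCa : 0 ≤ Ca) :
    ∀ᶠ β : ℝ in atTop, 2 * (190 * β * (2 * ((12 * (⌈β ^ θ⌉₊ : ℝ) ^ 2 + 2 * ⌈β ^ θ⌉₊ + 1) * (Real.sqrt 2 * Real.sqrt (β ^ (2 * (6 * θ) - 1)) + 8 * (Ca * β ^ (3 * θ + θ / 5 - 1 / 2))))) ^ 3) * (β ^ (2 * (6 * θ)) + (2 * (D : ℝ) * ((Real.sqrt (β * (CE * (2 * (⌈β ^ θ⌉₊ : ℝ) + 3) ^ 4 * β ^ (2 * (θ / 5) - 1))) + 4 * (Real.sqrt β * (Ca * β ^ (3 * θ + θ / 5 - 1 / 2)))) ^ 2 + 2))) ≤ β ^ (-(1 / 5 : ℝ)) / 5 := by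
  refine eventually_le_rpow_div_of_le_rpow (C := 380 * (106 * (Real.sqrt 2 + 8 * Ca)) ^ 3 * (1 + (2 * (D : ℝ) * ((49 * Real.sqrt CE + 4 * Ca) ^ 2 + 2)))) (s := 36 * θ - 1 / 2) (b := -(1 / 5 : ℝ))
    (by linarith) (by norm_num) (fun β hβ => ?_)
  have hβ0 : 0 < β := by linarith
  have hτ := cubicD_majorant hβ hθ.le hCa
  obtain ⟨hK1, -, -, -⟩ := momentsD_majorant (CE := CE) D hβ hθ.le hCa
  have hr0 : 0 ≤ Ca * β ^ (3 * θ + θ / 5 - 1 / 2) := mul_nonneg hCa (Real.rpow_nonneg hβ0.le _)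
  have hτ0 : 0 ≤ (190 * β * (2 * ((12 * (⌈β ^ θ⌉₊ : ℝ) ^ 2 + 2 * ⌈β ^ θ⌉₊ + 1) * (Real.sqrt 2 * Real.sqrt (β ^ (2 * (6 * θ) - 1)) + 8 * (Ca * β ^ (3 * θ + θ / 5 - 1 / 2))))) ^ 3) := by positivity
  have hk1 : 0 ≤ (2 * (D : ℝ) * ((49 * Real.sqrt CE + 4 * Ca) ^ 2 + 2)) := by positivity
  have hmono : β ^ (2 * (3 * θ + θ / 5)) ≤ β ^ (12 * θ) := Real.rpow_le_rpow_of_exponent_le hβ (by linarith)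
  have hMK : β ^ (2 * (6 * θ)) + (2 * (D : ℝ) * ((Real.sqrt (β * (CE * (2 * (⌈β ^ θ⌉₊ : ℝ) + 3) ^ 4 * β ^ (2 * (θ / 5) - 1))) + 4 * (Real.sqrt β * (Ca * β ^ (3 * θ + θ / 5 - 1 / 2)))) ^ 2 + 2)) ≤ (1 + (2 * (D : ℝ) * ((49 * Real.sqrt CE + 4 * Ca) ^ 2 + 2))) * β ^ (12 * θ) := by
    rw [rpow_two_mul_six]
    nlinarith
  have hMK0 : 0 ≤ β ^ (2 * (6 * θ)) + (2 * (D : ℝ) * ((Real.sqrt (β * (CE * (2 * (⌈β ^ θ⌉₊ : ℝ) + 3) ^ 4 * β ^ (2 * (θ / 5) - 1))) + 4 * (Real.sqrt β * (Ca * β ^ (3 * θ + θ / 5 - 1 / 2)))) ^ 2 + 2)) := by positivity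
  have e : β ^ (24 * θ - 1 / 2) * β ^ (12 * θ) = β ^ (36 * θ - 1 / 2) := by rw [← Real.rpow_add hβ0]; ring_nf
  have hpos : 0 ≤ (1 + (2 * (D : ℝ) * ((49 * Real.sqrt CE + 4 * Ca) ^ 2 + 2))) * β ^ (12 * θ) := by positivity
  calc 2 * (190 * β * (2 * ((12 * (⌈β ^ θ⌉₊ : ℝ) ^ 2 + 2 * ⌈β ^ θ⌉₊ + 1) * (Real.sqrt 2 * Real.sqrt (β ^ (2 * (6 * θ) - 1)) + 8 * (Ca * β ^ (3 * θ + θ / 5 - 1 / 2))))) ^ 3) * (β ^ (2 * (6 * θ)) + (2 * (D : ℝ) * ((Real.sqrt (β * (CE * (2 * (⌈β ^ θ⌉₊ : ℝ) + 3) ^ 4 * β ^ (2 * (θ / 5) - 1))) + 4 * (Real.sqrt β * (Ca * β ^ (3 * θ + θ / 5 - 1 / 2)))) ^ 2 + 2))) ≤ 2 * (190 * (106 * (Real.sqrt 2 + 8 * Ca)) ^ 3 * β ^ (24 * θ - 1 / 2)) * ((1 + (2 * (D : ℝ) * ((49 * Real.sqrt CE + 4 * Ca) ^ 2 + 2)))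 * β ^ (12 * θ)) := by
        gcongr
    _ = 380 * (106 * (Real.sqrt 2 + 8 * Ca)) ^ 3 * (1 + (2 * (D : ℝ) * ((49 * Real.sqrt CE + 4 * Ca) ^ 2 + 2))) * (β ^ (24 * θ - 1 / 2) * β ^ (12 * θ)) := by ring
    _ = _ := by rw [e]

/-- **C5** (Cauchy–Schwarz on the Gaussian bad event): `√P(2MK₁ + K₂ + K₁²) ≤ β^{−1/5}/5` eventually. -/
theorem eventually_covD_T5_sharp (D : ℕ) (hθ : 0 < θ) (hCa : 0 ≤ Ca) :
    ∀ᶠ β : ℝ in atTop, Real.sqrt (240 * (D : ℝ) * (2 * (⌈β ^ θ⌉₊ : ℝ) + 1) ^ 4 * Real.exp (-(β ^ (6 * θ) / (4 * (Real.sqrt D + 1))) ^ 2 / 2)) * (2 * β ^ (2 * (6 * θ)) * (2 * (D : ℝ) * ((Real.sqrt (β * (CE * (2 * (⌈β ^ θ⌉₊ : ℝ) + 3) ^ 4 * β ^ (2 * (θ / 5) - 1))) + 4 * (Real.sqrt β * (Ca * β ^ (3 * θ + θ / 5 - 1 / 2)))) ^ 2 + 2)) + (3 * (D : ℝ) ^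 2 * ((Real.sqrt (β * (CE * (2 * (⌈β ^ θ⌉₊ : ℝ) + 3) ^ 4 * β ^ (2 * (θ / 5) - 1))) + 4 * (Real.sqrt β * (Ca * β ^ (3 * θ + θ / 5 - 1 / 2)))) ^ 4 + 11)) + (2 * (D : ℝ) * ((Real.sqrt (β * (CE * (2 * (⌈β ^ θ⌉₊ : ℝ) + 3) ^ 4 * β ^ (2 * (θ / 5) - 1))) + 4 * (Real.sqrt β * (Ca * β ^ (3 * θ + θ / 5 - 1 / 2)))) ^ 2 + 2)) ^ 2) ≤ β ^ (-(1 / 5 : ℝ)) / 5 := by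
  have hb₀ : (0 : ℝ) < (1 / (64 * (Real.sqrt D + 1) ^ 2)) := by positivity
  refine eventually_le_rpow_div_of_le_rpow_mul_exp (C := Real.sqrt (150000 * (D : ℝ)) * (2 * (2 * (D : ℝ) * ((49 * Real.sqrt CE + 4 * Ca) ^ 2 + 2)) + (3 * (D : ℝ) ^ 2 * ((49 * Real.sqrt CE + 4 * Ca) ^ 4 + 11)) + (4 * (D : ℝ) ^ 2 * ((49 * Real.sqrt CE + 4 * Ca) ^ 2 + 2) ^ 2)))
    (s := 2 * θ + (12 * θ + 2 * (3 * θ + θ / 5))) (a := 12 * θ) (b₀ := (1 / (64 * (Real.sqrt D + 1) ^ 2))) (-(1 / 5 : ℝ)) (by positivity) hb₀ (by norm_num)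
    (fun β hβ => ?_)
  have hβ0 : 0 < β := by linarith
  obtain ⟨-, hsP⟩ := badMassD_majorant D hβ hθ.le
  obtain ⟨hK1, hK2, hK3, -⟩ := momentsD_majorant (CE := CE) D hβ hθ.le hCa
  have hR'0 := backgroundD_nonneg hβ0.le hCa θ CE
  have hK10 : 0 ≤ (2 * (D : ℝ) * ((Real.sqrt (β * (CE * (2 * (⌈β ^ θ⌉₊ : ℝ) + 3) ^ 4 * β ^ (2 * (θ / 5) - 1))) + 4 * (Real.sqrt β * (Ca * β ^ (3 * θ + θ / 5 - 1 / 2)))) ^ 2 + 2)) := by positivity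
  have hk1 : 0 ≤ (2 * (D : ℝ) * ((49 * Real.sqrt CE + 4 * Ca) ^ 2 + 2)) := by positivity
  have hk2 : 0 ≤ (3 * (D : ℝ) ^ 2 * ((49 * Real.sqrt CE + 4 * Ca) ^ 4 + 11)) := by positivity
  have hk3 : 0 ≤ (4 * (D : ℝ) ^ 2 * ((49 * Real.sqrt CE + 4 * Ca) ^ 2 + 2) ^ 2) := by positivity
  have hmono : β ^ (4 * (3 * θ + θ / 5)) ≤ β ^ (12 * θ + 2 * (3 * θ + θ / 5)) := Real.rpow_le_rpow_of_exponent_le hβ (by linarith)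
  have e1 : β ^ (12 * θ) * β ^ (2 * (3 * θ + θ / 5)) = β ^ (12 * θ + 2 * (3 * θ + θ / 5)) := by rw [← Real.rpow_add hβ0]
  have hpoly : 2 * β ^ (2 * (6 * θ)) * (2 * (D : ℝ) * ((Real.sqrt (β * (CE * (2 * (⌈β ^ θ⌉₊ : ℝ) + 3) ^ 4 * β ^ (2 * (θ / 5) - 1))) + 4 * (Real.sqrt β * (Ca * β ^ (3 * θ + θ / 5 - 1 / 2)))) ^ 2 + 2)) + (3 * (D : ℝ) ^ 2 * ((Real.sqrt (β * (CE * (2 * (⌈β ^ θ⌉₊ : ℝ) + 3) ^ 4 * β ^ (2 * (θ / 5) - 1))) + 4 * (Real.sqrt β * (Ca * β ^ (3 * θ + θ / 5 - 1 / 2)))) ^ 4 + 11)) + (2 * (D : ℝ) * ((Real.sqrt (β * (CE * (2 * (⌈β ^ θ⌉₊ : ℝ) + 3) ^ 4 * β ^ (2 * (θ / 5) - 1))) + 4 * (Real.sqrt β * (Ca * β ^ (3 * θ + θ / 5 - 1 / 2)))) ^ 2 + 2)) ^ 2 ≤ (2 * (2 * (D : ℝ) * ((49 * Real.sqrt CE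 + 4 * Ca) ^ 2 + 2)) + (3 * (D : ℝ) ^ 2 * ((49 * Real.sqrt CE + 4 * Ca) ^ 4 + 11)) + (4 * (D : ℝ) ^ 2 * ((49 * Real.sqrt CE + 4 * Ca) ^ 2 + 2) ^ 2)) * β ^ (12 * θ + 2 * (3 * θ + θ / 5)) := by
    rw [rpow_two_mul_six]
    have hM0 : 0 ≤ 2 * β ^ (12 * θ) := by positivity
    have h1 : 2 * β ^ (12 * θ) * (2 * (D : ℝ) * ((Real.sqrt (β * (CE * (2 * (⌈β ^ θ⌉₊ : ℝ) + 3) ^ 4 * β ^ (2 * (θ / 5) - 1))) + 4 * (Real.sqrt β * (Ca * β ^ (3 * θ + θ / 5 - 1 / 2)))) ^ 2 + 2)) ≤ 2 * (2 * (D : ℝ) * ((49 * Real.sqrt CE + 4 * Ca) ^ 2 + 2)) * β ^ (12 * θ + 2 * (3 * θ + θ / 5)) := by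
      calc 2 * β ^ (12 * θ) * (2 * (D : ℝ) * ((Real.sqrt (β * (CE * (2 * (⌈β ^ θ⌉₊ : ℝ) + 3) ^ 4 * β ^ (2 * (θ / 5) - 1))) + 4 * (Real.sqrt β * (Ca * β ^ (3 * θ + θ / 5 - 1 / 2)))) ^ 2 + 2)) ≤ 2 * β ^ (12 * θ) * ((2 * (D : ℝ) * ((49 * Real.sqrt CE + 4 * Ca) ^ 2 + 2)) * β ^ (2 * (3 * θ + θ / 5))) := mul_le_mul_of_nonneg_left hK1 hM0
        _ = 2 * (2 * (D : ℝ) * ((49 * Real.sqrt CE + 4 * Ca) ^ 2 + 2)) * (β ^ (12 * θ) * β ^ (2 * (3 * θ + θ / 5))) := by ring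
        _ = _ := by rw [e1]
    nlinarith
  have hpoly0 : 0 ≤ 2 * β ^ (2 * (6 * θ)) * (2 * (D : ℝ) * ((Real.sqrt (β * (CE * (2 * (⌈β ^ θ⌉₊ : ℝ) + 3) ^ 4 * β ^ (2 * (θ / 5) - 1))) + 4 * (Real.sqrt β * (Ca * β ^ (3 * θ + θ / 5 - 1 / 2)))) ^ 2 + 2)) + (3 * (D : ℝ) ^ 2 * ((Real.sqrt (β * (CE * (2 * (⌈β ^ θ⌉₊ : ℝ) + 3) ^ 4 * β ^ (2 * (θ / 5) - 1))) + 4 * (Real.sqrt β * (Ca * β ^ (3 * θ + θ / 5 - 1 / 2)))) ^ 4 + 11)) + (2 * (D : ℝ) * ((Real.sqrt (β * (CE * (2 * (⌈β ^ θ⌉₊ : ℝ) + 3) ^ 4 * β ^ (2 * (θ / 5) - 1))) + 4 * (Real.sqrt β * (Ca * β ^ (3 * θ + θ / 5 - 1 / 2)))) ^ 2 + 2)) ^ 2 := by positivity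
  have hsP0 : 0 ≤ Real.sqrt (240 * (D : ℝ) * (2 * (⌈β ^ θ⌉₊ : ℝ) + 1) ^ 4 * Real.exp (-(β ^ (6 * θ) / (4 * (Real.sqrt D + 1))) ^ 2 / 2)) := Real.sqrt_nonneg _
  have e2 : β ^ (2 * θ) * β ^ (12 * θ + 2 * (3 * θ + θ / 5)) = β ^ (2 * θ + (12 * θ + 2 * (3 * θ + θ / 5))) := by
    rw [← Real.rpow_add hβ0]
  have hE0 : 0 ≤ Real.exp (-((1 / (64 * (Real.sqrt D + 1) ^ 2)) * β ^ (12 * θ))) := (Real.exp_pos _).le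
  calc Real.sqrt (240 * (D : ℝ) * (2 * (⌈β ^ θ⌉₊ : ℝ) + 1) ^ 4 * Real.exp (-(β ^ (6 * θ) / (4 * (Real.sqrt D + 1))) ^ 2 / 2)) * (2 * β ^ (2 * (6 * θ)) * (2 * (D : ℝ) * ((Real.sqrt (β * (CE * (2 * (⌈β ^ θ⌉₊ : ℝ) + 3) ^ 4 * β ^ (2 * (θ / 5) - 1))) + 4 * (Real.sqrt β * (Ca * β ^ (3 * θ + θ / 5 - 1 / 2)))) ^ 2 + 2)) + (3 * (D : ℝ) ^ 2 * ((Real.sqrt (β * (CE * (2 * (⌈β ^ θ⌉₊ : ℝ) + 3) ^ 4 * β ^ (2 * (θ / 5) - 1))) + 4 * (Real.sqrt β * (Ca * β ^ (3 * θ + θ / 5 - 1 / 2)))) ^ 4 + 11)) + (2 * (D : ℝ) * ((Real.sqrt (β * (CE * (2 * (⌈β ^ θ⌉₊ : ℝ) + 3) ^ 4 * β ^ (2 * (θ / 5) - 1))) + 4 * (Real.sqrt β * (Ca * β ^ (3 * θ + θ / 5 - 1 / 2)))) ^ 2 + 2)) ^ 2)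
      ≤ (Real.sqrt (150000 * (D : ℝ)) * β ^ (2 * θ) * Real.exp (-((1 / (64 * (Real.sqrt D + 1) ^ 2)) * β ^ (12 * θ)))) * ((2 * (2 * (D : ℝ) * ((49 * Real.sqrt CE + 4 * Ca) ^ 2 + 2)) + (3 * (D : ℝ) ^ 2 * ((49 * Real.sqrt CE + 4 * Ca) ^ 4 + 11)) + (4 * (D : ℝ) ^ 2 * ((49 * Real.sqrt CE + 4 * Ca) ^ 2 + 2) ^ 2)) * β ^ (12 * θ + 2 * (3 * θ + θ / 5))) :=
        mul_le_mul hsP hpoly hpoly0 (by positivity)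
    _ = Real.sqrt (150000 * (D : ℝ)) * (2 * (2 * (D : ℝ) * ((49 * Real.sqrt CE + 4 * Ca) ^ 2 + 2)) + (3 * (D : ℝ) ^ 2 * ((49 * Real.sqrt CE + 4 * Ca) ^ 4 + 11)) + (4 * (D : ℝ) ^ 2 * ((49 * Real.sqrt CE + 4 * Ca) ^ 2 + 2) ^ 2)) * (β ^ (2 * θ) * β ^ (12 * θ + 2 * (3 * θ + θ / 5))) * Real.exp (-((1 / (64 * (Real.sqrt D + 1) ^ 2)) * β ^ (12 * θ))) := by ring
    _ = _ := by rw [e2]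

/-! ## The deliverable: the covariance clauses of `eventually_kernelDatum_boundsG` with the sharp error sum -/

set_option maxHeartbeats 800000 in
/-- **`eventually_kernelCov_boundsG_sharp`**: for `0 < θ ≤ 1/200` and all constants `N, D, Ca > 0, CE, r₂ > 0, C₂ ≥ 0, η₀ > 0`, eventually in
`β`: `1 ≤ β`, the link window `L ≤ η₀`, `m = 2L ≤ 1/4`, `m ≤ r₂`, the sandwich radius `mE ≤ m`, `r ≤ m`, the cost window
`(D/2)(R+R')²/β + 190m³ < β^{2(6θ)−1}`, the Gaussian bad mass `P ≤ 1/2`, and the SHARP covariance error sum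
`6(2Nβ)²pY + 3M²(e^{2w}−1) + 6M²P + 2τ(M+K₁) + √P(2MK₁+K₂+K₁²) ≤ β^{−1/5}` (`pY = e^{−β^{6θ}}`, `M = β^{12θ}`, `K₁ = 2D(R'²+2)`,
`K₂ = 3D²(R'⁴+11)`; the scaled background spelled `R' = √(β·B) + 4√β·r` as in `kernelCovG_sub_interface_le`). -/
theorem eventually_kernelCov_boundsG_sharp (N D : ℕ) {Ca CE r₂ C₂ η₀ θ : ℝ} (hCa : 0 < Ca) (hr₂ : 0 < r₂) (hC₂ : 0 ≤ C₂)
    (hη₀ : 0 < η₀) (hθ : 0 < θ) (hθ2 : θ ≤ 1 / 200) :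
    ∀ᶠ β : ℝ in atTop, 1 ≤ β ∧
      ((12 * (⌈β ^ θ⌉₊ : ℝ) ^ 2 + 2 * (⌈β ^ θ⌉₊ : ℝ) + 1) * (Real.sqrt 2 * Real.sqrt (β ^ (2 * (6 * θ) - 1)) + 8 * (Ca * β ^ (3 * θ + θ / 5 - 1 / 2)))) ≤ η₀ ∧
      (2 * ((12 * (⌈β ^ θ⌉₊ : ℝ) ^ 2 + 2 * (⌈β ^ θ⌉₊ : ℝ) + 1) * (Real.sqrt 2 * Real.sqrt (β ^ (2 * (6 * θ) - 1)) + 8 * (Ca * β ^ (3 * θ + θ / 5 - 1 / 2))))) ≤ 1 / 4 ∧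
      (2 * ((12 * (⌈β ^ θ⌉₊ : ℝ) ^ 2 + 2 * (⌈β ^ θ⌉₊ : ℝ) + 1) * (Real.sqrt 2 * Real.sqrt (β ^ (2 * (6 * θ) - 1)) + 8 * (Ca * β ^ (3 * θ + θ / 5 - 1 / 2))))) ≤ r₂ ∧
      (Real.sqrt D * ((12 * (⌈β ^ θ⌉₊ : ℝ) ^ 2 + 2 * (⌈β ^ θ⌉₊ : ℝ) + 1) * (((β ^ (6 * θ) / (4 * (Real.sqrt D + 1))) + (Real.sqrt (β * (CE * (2 * (⌈β ^ θ⌉₊ : ℝ) + 3) ^ 4 * β ^ (2 * (θ / 5) - 1))) + 4 * (Real.sqrt β * (Ca * β ^ (3 * θ + θ / 5 - 1 / 2))))) + 4 * (Real.sqrt β * (Ca * β ^ (3 * θ + θ / 5 - 1 / 2))))) / Real.sqrt β) ≤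
        (2 * ((12 * (⌈β ^ θ⌉₊ : ℝ) ^ 2 + 2 * (⌈β ^ θ⌉₊ : ℝ) + 1) * (Real.sqrt 2 * Real.sqrt (β ^ (2 * (6 * θ) - 1)) + 8 * (Ca * β ^ (3 * θ + θ / 5 - 1 / 2))))) ∧
      Ca * β ^ (3 * θ + θ / 5 - 1 / 2) ≤
        (2 * ((12 * (⌈β ^ θ⌉₊ : ℝ) ^ 2 + 2 * (⌈β ^ θ⌉₊ : ℝ) + 1) * (Real.sqrt 2 * Real.sqrt (β ^ (2 * (6 * θ) - 1)) + 8 * (Ca * β ^ (3 * θ + θ / 5 - 1 / 2))))) ∧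
      (D : ℝ) / 2 * ((β ^ (6 * θ) / (4 * (Real.sqrt D + 1))) + (Real.sqrt (β * (CE * (2 * (⌈β ^ θ⌉₊ : ℝ) + 3) ^ 4 * β ^ (2 * (θ / 5) - 1))) + 4 * (Real.sqrt β * (Ca * β ^ (3 * θ + θ / 5 - 1 / 2))))) ^ 2 / β + 190 * (2 * ((12 * (⌈β ^ θ⌉₊ : ℝ) ^ 2 + 2 * (⌈β ^ θ⌉₊ : ℝ) + 1) * (Real.sqrt 2 * Real.sqrt (β ^ (2 * (6 * θ) - 1)) + 8 * (Ca * β ^ (3 * θ + θ / 5 - 1 / 2))))) ^ 3 < β ^ (2 * (6 * θ) - 1) ∧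
      (240 * (D : ℝ) * (2 * (⌈β ^ θ⌉₊ : ℝ) + 1) ^ 4 * Real.exp (-(β ^ (6 * θ) / (4 * (Real.sqrt D + 1))) ^ 2 / 2)) ≤ 1 / 2 ∧
      6 * (2 * N * β) * (2 * N * β) * Real.exp (-(β ^ (6 * θ))) +
        (3 * (β ^ (2 * (6 * θ))) ^ 2 * (Real.exp (2 * (120 * (2 * (⌈β ^ θ⌉₊ : ℝ) + 1) ^ 4 * (190 * β * (2 * ((12 * (⌈β ^ θ⌉₊ : ℝ) ^ 2 + 2 * (⌈β ^ θ⌉₊ : ℝ) + 1) * (Real.sqrt 2 * Real.sqrt (β ^ (2 * (6 * θ) - 1)) + 8 * (Ca * β ^ (3 * θ + θ / 5 - 1 / 2))))) ^ 3) + 4 * (2 * (⌈β ^ θ⌉₊ : ℝ) + 1) ^ 4 * (2 * C₂ * (2 * ((12 * (⌈β ^ θ⌉₊ : ℝ) ^ 2 + 2 * (⌈β ^ θ⌉₊ : ℝ) + 1) * (Real.sqrt 2 * Real.sqrt (β ^ (2 * (6 * θ) - 1)) + 8 * (Ca * β ^ (3 * θ + θ / 5 - 1 / 2))))) ^ 2)))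 - 1) +
          6 * (β ^ (2 * (6 * θ))) ^ 2 * (240 * (D : ℝ) * (2 * (⌈β ^ θ⌉₊ : ℝ) + 1) ^ 4 * Real.exp (-(β ^ (6 * θ) / (4 * (Real.sqrt D + 1))) ^ 2 / 2)) +
          2 * (190 * β * (2 * ((12 * (⌈β ^ θ⌉₊ : ℝ) ^ 2 + 2 * (⌈β ^ θ⌉₊ : ℝ) + 1) * (Real.sqrt 2 * Real.sqrt (β ^ (2 * (6 * θ) - 1)) + 8 * (Ca * β ^ (3 * θ + θ / 5 - 1 / 2))))) ^ 3) * (β ^ (2 * (6 * θ)) + (2 * (D : ℝ) * ((Real.sqrt (β * (CE * (2 * (⌈β ^ θ⌉₊ : ℝ) + 3) ^ 4 * β ^ (2 * (θ / 5) - 1))) + 4 * (Real.sqrt β * (Ca * β ^ (3 * θ + θ / 5 - 1 / 2)))) ^ 2 + 2))) +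
          Real.sqrt (240 * (D : ℝ) * (2 * (⌈β ^ θ⌉₊ : ℝ) + 1) ^ 4 * Real.exp (-(β ^ (6 * θ) / (4 * (Real.sqrt D + 1))) ^ 2 / 2)) * (2 * β ^ (2 * (6 * θ)) * (2 * (D : ℝ) * ((Real.sqrt (β * (CE * (2 * (⌈β ^ θ⌉₊ : ℝ) + 3) ^ 4 * β ^ (2 * (θ / 5) - 1))) + 4 * (Real.sqrt β * (Ca * β ^ (3 * θ + θ / 5 - 1 / 2)))) ^ 2 + 2)) + (3 * (D : ℝ) ^ 2 * ((Real.sqrt (β * (CE * (2 * (⌈β ^ θ⌉₊ : ℝ) + 3) ^ 4 * β ^ (2 * (θ / 5) - 1))) + 4 * (Real.sqrt β * (Ca * β ^ (3 * θ + θ / 5 - 1 / 2)))) ^ 4 + 11)) + (2 * (D : ℝ) * ((Real.sqrt (β * (CE * (2 * (⌈β ^ θ⌉₊ : ℝ) + 3) ^ 4 * β ^ (2 * (θ / 5) - 1))) + 4 * (Real.sqrt β * (Ca * β ^ (3 * θ + θ / 5 - 1 / 2)))) ^ 2 + 2)) ^ 2)) ≤ β ^ (-(1 / 5 : ℝ))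 := by
  filter_upwards [eventually_ge_atTop (1 : ℝ), eventually_halfLinkD_le hθ hθ2 hCa.le hη₀,
    eventually_linkD_le hθ hθ2 hCa.le (by norm_num : (0 : ℝ) < 1 / 4), eventually_linkD_le hθ hθ2 hCa.le hr₂,
    eventually_windowD_aux (Ca := Ca) (CE := CE) D hθ hθ2, eventually_windowD_aux4 (Ca := Ca) hθ2, eventually_badMassD_le_half D hθ,
    eventually_covD_T1_sharp N hθ, eventually_covD_T2_sharp hθ hθ2 hCa.le hC₂, eventually_covD_T3_sharp D hθ,
    eventually_covD_T4_sharp (CE := CE) D hθ hθ2 hCa.le, eventually_covD_T5_sharp (CE := CE) D hθ hCa.le]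
    with β hβ hL hm4 hmr haux haux4 hP hc1 hc2 hc3 hc4 hc5
  have hβ0 : 0 < β := by linarith
  obtain ⟨haux1, haux2, -⟩ := haux
  obtain ⟨hmEm, -, -⟩ := mED_majorant (CE := CE) D hβ hθ.le hCa.le haux1
  have hwin := windowD_m_of (CE := CE) D hβ hθ.le hCa.le haux2 haux4
  -- `r ≤ m = 2·(12H²+2H+1)(√2·√(β^{2ε−1}) + 8r)`
  have hX : 0 ≤ Ca * β ^ (3 * θ + θ / 5 - 1 / 2) := by positivity
  have hS : 0 ≤ Real.sqrt 2 * Real.sqrt (β ^ (2 * (6 * θ) - 1)) := by positivity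
  have hP1 : (1 : ℝ) ≤ 12 * (⌈β ^ θ⌉₊ : ℝ) ^ 2 + 2 * (⌈β ^ θ⌉₊ : ℝ) + 1 := by
    have : (0 : ℝ) ≤ (⌈β ^ θ⌉₊ : ℝ) := Nat.cast_nonneg _
    nlinarith
  have h1 : Real.sqrt 2 * Real.sqrt (β ^ (2 * (6 * θ) - 1)) + 8 * (Ca * β ^ (3 * θ + θ / 5 - 1 / 2)) ≤
      (12 * (⌈β ^ θ⌉₊ : ℝ) ^ 2 + 2 * (⌈β ^ θ⌉₊ : ℝ) + 1) *
        (Real.sqrt 2 * Real.sqrt (β ^ (2 * (6 * θ) - 1)) + 8 * (Ca * β ^ (3 * θ + θ / 5 - 1 / 2))) :=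
    le_mul_of_one_le_left (by positivity) hP1
  have hrm : Ca * β ^ (3 * θ + θ / 5 - 1 / 2) ≤
      2 * ((12 * (⌈β ^ θ⌉₊ : ℝ) ^ 2 + 2 * (⌈β ^ θ⌉₊ : ℝ) + 1) *
        (Real.sqrt 2 * Real.sqrt (β ^ (2 * (6 * θ) - 1)) + 8 * (Ca * β ^ (3 * θ + θ / 5 - 1 / 2)))) := by linarith
  exact ⟨hβ, hL, hm4, hmr, hmEm, hrm, hwin, hP, by linarith⟩

end Summit.QuantumFields.YangMills.Theorems.ColdBoxAllGroups

end
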